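import Literature.AnabelianGeometry.SemiGraphs.SemiGraphLocal
import Literature.AnabelianGeometry.SemiGraphs.GraphOfAnabelioids
import Literature.AnabelianGeometry.Anabelioids.AutOfEquivalence

/-!
# Nested sub-semi-graphs `K ⊆ ℍ ⊆ 𝔾`: restriction in stages ([SemiAnbd] §1 p. 12, Def. 2.1 p. 24; [IUTchI] §2 p. 44)

Mochizuki, *Semi-graphs of anabelioids*, Publ. RIMS **42** (2006), §1 p. 12 (sub-semi-graphs) and
Def. 2.1 p. 24: "`𝒢_ℍ` … the semi-graph of anabelioids obtained by restricting `𝒢` to `ℍ`", with the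
natural `Π_ℍ → Π_𝒢` [cite: MochizukiSemiAnbd2006, Def. 2.1 p.24]; Mochizuki, *Inter-universal
Teichmüller theory I*, §2 p. 44: for a connected sub-semi-graph `ℍ ⊆ 𝔾`, "the restriction of `ℋ` to
the maximal subgraph of `ℍ`" and the decomposition subgroup `Π̂_ℍ ⊆ Π̂_𝔾` read after "omission of
some of the cuspidal edges" [cite: Mochizuki2012, §2 p.44].

Moving a statement about `Π_ℍ ⊆ Π_𝔾` across a cusp omission `𝔾' ⊆ 𝔾` (e.g. [SemiAnbd] Cor. 2.7 (i),
which binds GRAPHS of anabelioids, applied to `𝔾' = ` maximal subgraph) needs the elementary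
two-level bookkeeping typed here (abc-iut L3, row W4-30 / L5 residue r2; DEFINITIONS + their
definitional laws; no fact asserted):

* `SemiGraph.Subgraph.restrictTo K H` — `K ∩ H` as a sub-semi-graph of `H` (for `K, H ⊆ G`);
* `SemiGraph.Subgraph.closedPart K` — "the maximal subgraph of `K`" as a sub-semi-graph of `G`:
  the vertices of `K` and the edges of `K` that are CLOSED IN `K` (both branches abut to vertices
  of `K`), cf. [IUTchI] p. 44 "the restriction of `ℋ` to the maximal subgraph of `ℍ`";
* `SemiGraphOfAnabelioids.restrictToComparison K H : B(𝒢_K) ⥤ B((𝒢_ℍ)_{K ∩ ℍ})` — re-indexing a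
  system `{S_v, T_e, ψ_b}` over `K` to the components of `ℍ` lying in `K`, with
  `(−)|_K ⋙ restrictToComparison = (−)|_ℍ ⋙ (−)|_{K ∩ ℍ}` DEFINITIONALLY
  (`restrictFunctor_comp_restrictToComparison`); an isomorphism of categories when `K ⊆ ℍ`
  (`isEquivalence_restrictToComparison`), whence `range_piHToPi_eq_map_range`: the image of
  `Π_K → Π_𝒢` is the image under `Π_ℍ → Π_𝒢` of the image of `Π_{K ∩ ℍ} → Π_ℍ`.

The cusp-omission application ([SemiAnbd] Cor. 2.7 (i) for semi-graphs of anabelioids WITH cusps) is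
the proof-only companion `CuspOmissionSubgraph.lean`.  Nothing here takes a side on [IUTchIII]
Cor. 3.12.
-/

namespace Literature.AnabelianGeometry.SemiGraphs

open CategoryTheory
open Literature.AnabelianGeometry.Anabelioids

universe w v₁ u₁ u

namespace SemiGraph

variable {G : SemiGraph.{u}}

/-! ### `K ∩ H ⊆ H` and the maximal subgraph of a sub-semi-graph (§1 pp. 12–13) -/

/-- A sub-semi-graph `K ⊆ G` viewed inside another sub-semi-graph `H ⊆ G`, i.e. `K ∩ H` as a
sub-semi-graph of `H`: the vertices and edges of `H` that lie in `K`.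
[cite: MochizukiSemiAnbd2006, §1 p.12] -/
def Subgraph.restrictTo (K H : G.Subgraph) : H.toSemiGraph.Subgraph where
  verts := {v | v.1 ∈ K.verts}
  edges := {e | e.1 ∈ K.edges}

/-- Vertices of `K ∩ H ⊆ H`. [cite: MochizukiSemiAnbd2006, §1 p.12] -/
@[simp] theorem Subgraph.mem_restrictTo_verts (K H : G.Subgraph) (v : H.toSemiGraph.Vertex) :
    v ∈ (K.restrictTo H).verts ↔ v.1 ∈ K.verts := Iff.rfl

/-- Edges of `K ∩ H ⊆ H`. [cite: MochizukiSemiAnbd2006, §1 p.12] -/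
@[simp] theorem Subgraph.mem_restrictTo_edges (K H : G.Subgraph) (e : H.toSemiGraph.Edge) :
    e ∈ (K.restrictTo H).edges ↔ e.1 ∈ K.edges := Iff.rfl

/-- The *closed part* of a sub-semi-graph `K ⊆ G`: the sub-semi-graph of `G` with the vertices of
`K` and those edges of `K` that are closed IN `K` (i.e. the maximal subgraph of `K`, [SemiAnbd] §1
p. 13, viewed in `G`; [IUTchI] §2 p. 44 "the restriction of `ℋ` to the maximal subgraph of `ℍ`").
[cite: MochizukiSemiAnbd2006, §1 p.13] -/
def Subgraph.closedPart (K : G.Subgraph) : G.Subgraph where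
  verts := K.verts
  edges := {e | ∃ he : e ∈ K.edges, K.toSemiGraph.IsClosedEdge ⟨e, he⟩}

/-- The closed part has the same vertices. [cite: MochizukiSemiAnbd2006, §1 p.13] -/
@[simp] theorem Subgraph.closedPart_verts (K : G.Subgraph) : K.closedPart.verts = K.verts := rfl

/-- The edges of the closed part are edges of `K`. [cite: MochizukiSemiAnbd2006, §1 p.13] -/
theorem Subgraph.closedPart_edges_subset (K : G.Subgraph) : K.closedPart.edges ⊆ K.edges :=
  fun _ ⟨he, _⟩ => he

/-- Membership of an edge in the closed part: it is an edge of `K` closed in `K`.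
[cite: MochizukiSemiAnbd2006, §1 p.13] -/
theorem Subgraph.mem_closedPart_edges_iff (K : G.Subgraph) (e : G.Edge) :
    e ∈ K.closedPart.edges ↔ ∃ he : e ∈ K.edges, K.toSemiGraph.IsClosedEdge ⟨e, he⟩ := Iff.rfl

/-- Inside `K`, the closed part is the maximal subgraph of `K` (same vertices and edges).
[cite: MochizukiSemiAnbd2006, §1 p.13] -/
theorem Subgraph.closedPart_restrictTo_self (K : G.Subgraph) :
    K.closedPart.restrictTo K = K.toSemiGraph.maximalSubgraph := by
  ext x
  · exact ⟨fun _ => trivial, fun _ => x.2⟩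
  · change (∃ he : x.1 ∈ K.edges, K.toSemiGraph.IsClosedEdge ⟨x.1, he⟩) ↔
      K.toSemiGraph.IsClosedEdge x
    exact ⟨fun ⟨_, h⟩ => h, fun h => ⟨x.2, h⟩⟩

end SemiGraph

namespace SemiGraphOfAnabelioids

variable (𝒢 : SemiGraphOfAnabelioids.{v₁, u₁, u})

/-! ### Restriction in stages: `B(𝒢_K) ⥤ B((𝒢_ℍ)_{K ∩ ℍ})` (Def. 2.1 p. 24) -/

/-- **Comparison of the two restrictions to `K ∩ ℍ`**: the functor `B(𝒢_K) ⥤ B((𝒢_ℍ)_{K ∩ ℍ})`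
re-indexing a system `{S_v, T_e, ψ_b}` over `K` to the vertices and edges of `ℍ` lying in `K` (the
constituent anabelioids and gluing functors of `(𝒢_ℍ)_{K ∩ ℍ}` and of `𝒢_K` at such a component are
the same, [SemiAnbd] p. 24 "`(𝒢_ℍ)_c := 𝒢_c`"). [cite: MochizukiSemiAnbd2006, Def. 2.1 p.24] -/
noncomputable def restrictToComparison (K H : 𝒢.graph.Subgraph) :
    (𝒢.restrict K).BObj ⥤ ((𝒢.restrict H).restrict (K.restrictTo H)).BObj where
  obj A :=
    { S := fun v => A.S ⟨v.1.1, v.2⟩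
      T := fun e => A.T ⟨e.1.1, e.2⟩
      ψ := fun b v h => A.ψ ⟨b.1.1, b.2⟩ ⟨v.1.1, v.2⟩
        ((K.abuts_eq_some_iff _ _).mpr
          ((H.abuts_eq_some_iff _ _).mp (((K.restrictTo H).abuts_eq_some_iff b v).mp h))) }
  map f :=
    { fS := fun v => f.fS ⟨v.1.1, v.2⟩
      fT := fun e => f.fT ⟨e.1.1, e.2⟩
      comm := fun b v h => f.comm ⟨b.1.1, b.2⟩ ⟨v.1.1, v.2⟩ _ }

/-- **`(−)|_K ⋙ restrictToComparison = (−)|_ℍ ⋙ (−)|_{K ∩ ℍ}`** (definitional): restricting from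
`𝔾` to `K` and re-indexing is restricting to `ℍ` and then to `K ∩ ℍ`.
[cite: MochizukiSemiAnbd2006, Def. 2.1 p.24] -/
theorem restrictFunctor_comp_restrictToComparison (K H : 𝒢.graph.Subgraph) :
    𝒢.restrictFunctor K ⋙ 𝒢.restrictToComparison K H =
      𝒢.restrictFunctor H ⋙ (𝒢.restrict H).restrictFunctor (K.restrictTo H) := rfl

/-- The comparison functor followed by restriction to a vertex `w ∈ K ∩ ℍ` is restriction to `w`
(definitional). [cite: MochizukiSemiAnbd2006, Def. 2.1 p.24] -/
theorem restrictToComparison_comp_ρ (K H : 𝒢.graph.Subgraph)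
    (w : (K.restrictTo H).toSemiGraph.Vertex) :
    𝒢.restrictToComparison K H ⋙ ((𝒢.restrict H).restrict (K.restrictTo H)).ρ w =
      (𝒢.restrict K).ρ ⟨w.1.1, w.2⟩ := rfl

variable {𝒢} {K H : 𝒢.graph.Subgraph}

/-- For `K ⊆ ℍ`, the comparison functor `B(𝒢_K) ⥤ B((𝒢_ℍ)_{K ∩ ℍ})` is faithful.
[cite: MochizukiSemiAnbd2006, Def. 2.1 p.24] -/
theorem restrictToComparison_faithful (hV : K.verts ⊆ H.verts) (hE : K.edges ⊆ H.edges) :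
    (𝒢.restrictToComparison K H).Faithful :=
  ⟨fun {A B} f g hfg => by
    apply BObj.hom_ext
    · funext w
      exact congrArg (fun k : (𝒢.restrictToComparison K H).obj A ⟶ (𝒢.restrictToComparison K H).obj B =>
        k.fS ⟨⟨w.1, hV w.2⟩, w.2⟩) hfg
    · funext e
      exact congrArg (fun k : (𝒢.restrictToComparison K H).obj A ⟶ (𝒢.restrictToComparison K H).obj B =>
        k.fT ⟨⟨e.1, hE e.2⟩, e.2⟩) hfg⟩

/-- For `K ⊆ ℍ`, the comparison functor `B(𝒢_K) ⥤ B((𝒢_ℍ)_{K ∩ ℍ})` is full.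
[cite: MochizukiSemiAnbd2006, Def. 2.1 p.24] -/
theorem restrictToComparison_full (hV : K.verts ⊆ H.verts) (hE : K.edges ⊆ H.edges) :
    (𝒢.restrictToComparison K H).Full :=
  ⟨fun {_ _} g =>
    ⟨{ fS := fun w => g.fS ⟨⟨w.1, hV w.2⟩, w.2⟩
       fT := fun e => g.fT ⟨⟨e.1, hE e.2⟩, e.2⟩
       comm := fun b w h => g.comm ⟨⟨b.1, hE b.2⟩, b.2⟩ ⟨⟨w.1, hV w.2⟩, w.2⟩
         (((K.restrictTo H).abuts_eq_some_iff _ _).mpr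
           ((H.abuts_eq_some_iff _ _).mpr ((K.abuts_eq_some_iff b w).mp h))) }, rfl⟩⟩

/-- For `K ⊆ ℍ`, the comparison functor `B(𝒢_K) ⥤ B((𝒢_ℍ)_{K ∩ ℍ})` is essentially surjective
(indeed surjective on objects: re-index back). [cite: MochizukiSemiAnbd2006, Def. 2.1 p.24] -/
theorem restrictToComparison_essSurj (hV : K.verts ⊆ H.verts) (hE : K.edges ⊆ H.edges) :
    (𝒢.restrictToComparison K H).EssSurj :=
  ⟨fun A' =>
    ⟨{ S := fun w => A'.S ⟨⟨w.1, hV w.2⟩, w.2⟩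
       T := fun e => A'.T ⟨⟨e.1, hE e.2⟩, e.2⟩
       ψ := fun b w h => A'.ψ ⟨⟨b.1, hE b.2⟩, b.2⟩ ⟨⟨w.1, hV w.2⟩, w.2⟩
         (((K.restrictTo H).abuts_eq_some_iff _ _).mpr
           ((H.abuts_eq_some_iff _ _).mpr ((K.abuts_eq_some_iff b w).mp h))) },
      ⟨Iso.refl _⟩⟩⟩

/-- **For `K ⊆ ℍ ⊆ 𝔾`, `B(𝒢_K) ⥤ B((𝒢_ℍ)_{K ∩ ℍ})` is an equivalence** (an isomorphism of
categories: the two restrictions to `K` are the same data).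
[cite: MochizukiSemiAnbd2006, Def. 2.1 p.24] -/
theorem isEquivalence_restrictToComparison (hV : K.verts ⊆ H.verts) (hE : K.edges ⊆ H.edges) :
    (𝒢.restrictToComparison K H).IsEquivalence :=
  { faithful := restrictToComparison_faithful hV hE
    full := restrictToComparison_full hV hE
    essSurj := restrictToComparison_essSurj hV hE }

/-- **The image of `Π_K → Π_𝒢` seen through `Π_ℍ`**: for ANY sub-semi-graphs `K, ℍ ⊆ 𝔾` and a
vertex `w ∈ K ∩ ℍ`, the image of `Π_{K ∩ ℍ} → Π_ℍ → Π_𝒢` is contained in the image of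
`Π_K → Π_𝒢` (all basepoints through `w`; it is `π₁` of `(−)|_K ⋙ restrictToComparison`).
[cite: MochizukiSemiAnbd2006, Def. 2.1 p.24] -/
theorem map_range_piHToPi_restrictTo_le (K H : 𝒢.graph.Subgraph)
    (w : (K.restrictTo H).toSemiGraph.Vertex) (F : 𝒢.V w.1.1 ⥤ FintypeCat.{w}) :
    ((𝒢.restrict H).piHToPi (K.restrictTo H) w F).range.map (𝒢.piHToPi H w.1 F) ≤
      (𝒢.piHToPi K ⟨w.1.1, w.2⟩ F).range := by
  rw [MonoidHom.map_range]
  change (pi1Map (𝒢.restrictFunctor K ⋙ 𝒢.restrictToComparison K H)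
    (((𝒢.restrict H).restrict (K.restrictTo H)).ρ w ⋙ F)).range ≤ _
  change ((pi1Map (𝒢.restrictFunctor K)
      (𝒢.restrictToComparison K H ⋙ ((𝒢.restrict H).restrict (K.restrictTo H)).ρ w ⋙ F)).comp
    (pi1Map (𝒢.restrictToComparison K H)
      (((𝒢.restrict H).restrict (K.restrictTo H)).ρ w ⋙ F))).range ≤ _
  exact (MonoidHom.range_comp _ _).trans_le (Subgroup.map_le_range _ _)

/-- **The image of `Π_K → Π_𝒢` through `Π_ℍ`, for `K ⊆ ℍ ⊆ 𝔾`**: the image of `Π_K → Π_𝒢` IS the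
image under `Π_ℍ → Π_𝒢` of the image of `Π_{K ∩ ℍ} → Π_ℍ` (all basepoints through a vertex `w` of
`K`). [cite: MochizukiSemiAnbd2006, Cor. 2.7(i) p.30] -/
theorem range_piHToPi_eq_map_range (hV : K.verts ⊆ H.verts) (hE : K.edges ⊆ H.edges)
    (w : K.toSemiGraph.Vertex) (F : 𝒢.V w.1 ⥤ FintypeCat.{w}) :
    (𝒢.piHToPi K w F).range =
      ((𝒢.restrict H).piHToPi (K.restrictTo H) ⟨⟨w.1, hV w.2⟩, w.2⟩ F).range.map
        (𝒢.piHToPi H ⟨w.1, hV w.2⟩ F) := by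
  haveI := isEquivalence_restrictToComparison (𝒢 := 𝒢) hV hE
  refine Eq.trans ?_ (MonoidHom.range_comp _ _)
  -- `Π_{K ∩ ℍ} → Π_ℍ → Π_𝒢` is `π₁` of `(−)|_ℍ ⋙ (−)|_{K ∩ ℍ} = (−)|_K ⋙ restrictToComparison`
  -- (definitional), i.e. `π₁(restrictToComparison)` followed by `π₁((−)|_K)`; the former is onto.
  change _ = ((pi1Map (𝒢.restrictFunctor K) (𝒢.restrictToComparison K H ⋙
      ((𝒢.restrict H).restrict (K.restrictTo H)).ρ ⟨⟨w.1, hV w.2⟩, w.2⟩ ⋙ F)).comp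
    (pi1Map (𝒢.restrictToComparison K H)
      (((𝒢.restrict H).restrict (K.restrictTo H)).ρ ⟨⟨w.1, hV w.2⟩, w.2⟩ ⋙ F))).range
  refine Eq.trans ?_ (MonoidHom.range_comp _ _).symm
  rw [MonoidHom.range_eq_top.mpr (pi1Map_surjective_of_isEquivalence (𝒢.restrictToComparison K H) _),
    ← MonoidHom.range_eq_map]
  rfl

end SemiGraphOfAnabelioids

end Literature.AnabelianGeometry.SemiGraphs
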